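import Summits.ABC.ABC.Theorems.TwistAmplificationSharpModerateLawLatticeKey

/-!
# Lattice half of `SharpModerateLaw`: `stub_latticeHalf` (crux stmt-ABC-1975)

Kane's lattice upper bound (arXiv:1104.2635, Lemma 4, Prop. 5, Prop. 6) transported from
`A + B + C = 0` to one value of the index form of a MAXIMAL cubic ring, on a dyadic `Mplus`-shell,
uniformly in the form: for `F` maximal, `D ≠ 0`, `t ≥ 1`, `Y, B, w ≥ 1`, the primitive `q` with
`Y ≤ Mplus F q < 2Y`, `F(q) ≠ 0`, `t ∣ D F(q)`, `rad(D F(q)) ≤ B`, `depthRad F(q) ≤ w` number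
`≤ C_ε (|D| Y B t)^ε (B Y^{-1/6}/rad(D t) + w)` (registered stub `stub_latticeHalf`, line
`syzygy-lattice-half-deep-few-primes`; consumed verbatim by `stub_fewDeepOfLattice`).

Proof: for a member `q` put `n = |F(q)|`, `P₀ = primes(|D| t)`, `M = keyM P₀ n` (file LatticeKey),
so `n = M u` with `u ≤ B/(rad(|D|t) V(M))` by the radical budget; the members with a given `M` are
counted by `perM_bound` (≤ 3 Hensel classes per prime, Kane's Lemma 4 on three root parallelograms of
the shell), and the moduli `M ≤ √(2Y)` with given depth carrier `V(M) = s ≤ min(w, B)` are counted by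
Rankin's bound (`AbcHits.supportedCount_le_rankin`, Kane's Prop. 5); summing `A/s + 6` over `s`
(harmonic sum) gives the claim with `4δ = min(ε, 1)`.
-/

noncomputable section

namespace Summit.ABC.ABC.Theorems.SharpModerateLaw

open Literature.NumberTheory.CubicFields
open UniqueFactorizationMonoid
open Finset

/-! ## Assembly: the lattice half -/

set_option maxHeartbeats 400000 in
/-- **The lattice half** (registered stub `stub_latticeHalf` of crux stmt-ABC-1975, line
`syzygy-lattice-half-deep-few-primes`): Kane's lattice upper bound (arXiv:1104.2635, Lemma 4,
Prop. 5, Prop. 6) on a dyadic `Mplus`-shell, uniformly over maximal binary cubic forms. -/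
theorem stub_latticeHalf : LatticeHalf := by
  intro ε hε
  -- exponents and constants
  set δ : ℝ := min ε 1 / 4 with hδdef
  have hδ : 0 < δ := by have := lt_min hε one_pos; positivity
  have hδε : 4 * δ ≤ ε := by have := min_le_left ε 1; linarith
  have hδ1 : δ ≤ 1 := by have := min_le_right ε 1; linarith
  obtain ⟨K₁, hK₁, hK₁b⟩ := Literature.NumberTheory.DiophantineGeometry.AbcHits.rankinFactor_primeFactors_le hδ
  obtain ⟨K₃, hK₃, hK₃b⟩ := pow_card_primeFactors_le (c := 3) (by norm_num) hδ
  refine ⟨4 * 12288 * K₁ * K₃ * (1 + 1 / δ), ?_⟩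
  intro F hmax hD t ht Y B w hY hB hw
  classical
  -- the quantities
  set Dn : ℕ := F.disc.natAbs with hDndef
  have hDn : 0 < Dn := Int.natAbs_pos.mpr hD
  have ht0 : 0 < t := ht
  set P₀ : Finset ℕ := (Dn * t).primeFactors with hP₀def
  set R : ℕ := radical (Dn * t) with hRdef
  have hR : ((radical (F.disc * (t : ℤ)).natAbs : ℕ) : ℝ) = R := by
    rw [hRdef, Int.natAbs_mul, Int.natAbs_natCast]
  rw [hR]
  have hRpos : (0 : ℝ) < R := by exact_mod_cast Nat.radical_pos _
  have hRprod : ∏ p ∈ P₀, p = R := Nat.radical_eq_prod_primeFactors.symm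
  set N₀ : ℕ := ⌊Real.sqrt (2 * Y)⌋₊ with hN₀def
  set Smax : ℕ := ⌊min w B⌋₊ with hSmaxdef
  set A : ℝ := 12288 * B * Y ^ (-(1 / 6 : ℝ)) / R with hAdef
  set X : ℝ := (Dn : ℝ) * Y * B * t with hXdef
  set S := {q : ℤ × ℤ | Int.gcd q.1 q.2 = 1 ∧ Y ≤ (Mplus F q : ℝ) ∧ (Mplus F q : ℝ) < 2 * Y ∧
      F.eval q.1 q.2 ≠ 0 ∧ (t : ℤ) ∣ F.disc * F.eval q.1 q.2 ∧
      ((radical (F.disc * F.eval q.1 q.2).natAbs : ℕ) : ℝ) ≤ B ∧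
      ((depthRad (F.eval q.1 q.2).natAbs : ℕ) : ℝ) ≤ w} with hSdef
  have hY0 : 0 < Y := by linarith
  have hApos : 0 ≤ A := by positivity
  -- basic facts on the members of `S`
  let nq : ℤ × ℤ → ℕ := fun q => (F.eval q.1 q.2).natAbs
  have hnq_cast : ∀ q : ℤ × ℤ, (nq q : ℝ) = |(F.eval q.1 q.2 : ℝ)| := by
    intro q; simp only [nq, Nat.cast_natAbs, Int.cast_abs]
  have habsF : ∀ q ∈ S, |(F.eval q.1 q.2 : ℝ)| ≤ Real.sqrt (2 * Y) := by
    intro q hq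
    have h := hq.2.2.1
    rw [mplus_cast, max_lt_iff] at h
    refine Real.abs_le_sqrt ?_
    have hD1 : (1 : ℝ) ≤ |(F.disc : ℝ)| := by
      rw [← Int.cast_abs]; exact_mod_cast Int.one_le_abs hD
    nlinarith [h.1, sq_nonneg (F.eval q.1 q.2 : ℝ)]
  have hnq0 : ∀ q ∈ S, nq q ≠ 0 := fun q hq => Int.natAbs_ne_zero.mpr hq.2.2.2.1
  have hnqN : ∀ q ∈ S, nq q ≤ N₀ := fun q hq =>
    Nat.le_floor (by rw [hnq_cast]; exact habsF q hq)
  -- finiteness of `S`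
  have hm1 : 0 < Real.sqrt (2 * Y) + 1 := by positivity
  obtain ⟨hfin1, -⟩ := latticeShell_count F hD hY0 hm1 (q₀ := ((1 : ℤ), (0 : ℤ))) (by simp)
    Nat.one_pos
  have hSfin : S.Finite := hfin1.subset fun q hq =>
    ⟨hq.1, by simp, hq.2.1, hq.2.2.1, by linarith [habsF q hq]⟩
  -- the radical budget of a member
  have hbudget : ∀ q ∈ S, (uPart P₀ (nq q) * vPart P₀ (keyM P₀ (nq q)) * R : ℕ) ≤
      radical (Dn * nq q) ∧ ((radical (Dn * nq q) : ℕ) : ℝ) ≤ B := by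
    intro q hq
    have hDnq : Dn * nq q ≠ 0 := Nat.mul_ne_zero hDn.ne' (hnq0 q hq)
    refine ⟨?_, ?_⟩
    · rw [← hRprod]
      refine uPart_mul_vPart_mul_le P₀ (Nat.primeFactors_mono (Dvd.intro_left _ rfl) hDnq) ?_
      intro p hp
      have hpp := Nat.prime_of_mem_primeFactors hp
      refine Nat.mem_primeFactors.mpr ⟨hpp, ?_, hDnq⟩
      have h1 : p ∣ Dn * t := Nat.dvd_of_mem_primeFactors hp
      have h2 : t ∣ Dn * nq q := by
        have := hq.2.2.2.2.1
        rw [← Int.natAbs_dvd_natAbs, Int.natAbs_natCast, Int.natAbs_mul] at this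
        exact this
      rcases (Nat.Prime.dvd_mul hpp).mp h1 with h | h
      · exact h.mul_right _
      · exact h.trans h2
    · have := hq.2.2.2.2.2.1
      rwa [Int.natAbs_mul] at this
  -- the key modulus of a member: size, budget, depth
  have hkey : ∀ q ∈ S, 1 ≤ keyM P₀ (nq q) ∧ keyM P₀ (nq q) ≤ N₀ ∧
      1 ≤ vPart P₀ (keyM P₀ (nq q)) ∧ vPart P₀ (keyM P₀ (nq q)) ≤ Smax ∧
      (nq q : ℝ) ≤ keyM P₀ (nq q) * B / (R * vPart P₀ (keyM P₀ (nq q))) := by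
    intro q hq
    set n := nq q
    set M := keyM P₀ n
    set sv := vPart P₀ M
    have hn0 := hnq0 q hq
    have hM1 : 1 ≤ M := keyM_pos P₀ n
    have hsv1 : 1 ≤ sv := vPart_pos P₀ M
    have hu1 : 1 ≤ uPart P₀ n := uPart_pos P₀ n
    have hMn : M ≤ n := Nat.le_of_dvd (Nat.pos_of_ne_zero hn0) ⟨_, (keyM_mul_uPart P₀ hn0).symm⟩
    obtain ⟨hb1, hb2⟩ := hbudget q hq
    have hb : ((uPart P₀ n : ℕ) : ℝ) * sv * R ≤ B := by
      have : ((uPart P₀ n * sv * R : ℕ) : ℝ) ≤ B := le_trans (by exact_mod_cast hb1) hb2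
      push_cast at this; exact this
    refine ⟨hM1, hMn.trans (hnqN q hq), hsv1, ?_, ?_⟩
    · refine Nat.le_floor (le_min ?_ ?_)
      · have h1 : sv ∣ depthRad n := vPart_dvd_depthRad P₀ hn0
        have h2 : 0 < depthRad n := Nat.radical_pos _
        calc (sv : ℝ) ≤ depthRad n := by exact_mod_cast Nat.le_of_dvd h2 h1
          _ ≤ w := hq.2.2.2.2.2.2
      · have hR1 : (1 : ℝ) ≤ R := by exact_mod_cast Nat.radical_pos _
        have hu1' : (1 : ℝ) ≤ uPart P₀ n := by exact_mod_cast hu1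
        calc (sv : ℝ) = 1 * sv * 1 := by ring
          _ ≤ (uPart P₀ n : ℝ) * sv * R := by gcongr
          _ ≤ B := hb
    · have hsvR : (0 : ℝ) < R * sv := by positivity
      rw [le_div_iff₀ hsvR]
      have hnMu : (n : ℝ) = M * uPart P₀ n := by exact_mod_cast (keyM_mul_uPart P₀ hn0).symm
      rw [hnMu]
      calc (M : ℝ) * uPart P₀ n * (R * sv) = M * ((uPart P₀ n : ℝ) * sv * R) := by ring
        _ ≤ M * B := by gcongr
  -- index sets
  let I : ℕ → Finset ℕ := fun sv => ((Finset.Icc 1 N₀).filter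
    (fun M => M.primeFactors ⊆ (Dn * t * sv).primeFactors)).filter (fun M => vPart P₀ M = sv)
  set SF := hSfin.toFinset with hSFdef
  have hmemSF : ∀ q, q ∈ SF ↔ q ∈ S := fun q => Set.Finite.mem_toFinset hSfin
  have hcover : SF ⊆ (Finset.Icc 1 Smax).biUnion fun sv => (I sv).biUnion fun M =>
      SF.filter (fun q => keyM P₀ (nq q) = M) := by
    intro q hq
    have hqS := (hmemSF q).mp hq
    obtain ⟨hM1, hMN, hsv1, hsvS, -⟩ := hkey q hqS
    simp only [Finset.mem_biUnion, Finset.mem_Icc, Finset.mem_filter, I]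
    refine ⟨vPart P₀ (keyM P₀ (nq q)), ⟨hsv1, hsvS⟩, keyM P₀ (nq q), ⟨⟨⟨hM1, hMN⟩, ?_⟩, rfl⟩, hq, rfl⟩
    have hne : Dn * t * vPart P₀ (keyM P₀ (nq q)) ≠ 0 := by positivity
    rw [Nat.primeFactors_mul (by positivity) (by positivity)]
    exact primeFactors_subset_vPart P₀ _
  -- per-piece bound
  have hN₀pos : ∀ {M : ℕ}, 1 ≤ M → M ≤ N₀ → (3 : ℝ) ^ M.primeFactors.card ≤ K₃ * (N₀ : ℝ) ^ δ := by
    intro M hM1 hMN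
    refine (hK₃b M (by omega)).trans ?_
    gcongr
  have hpiece : ∀ sv ∈ Finset.Icc 1 Smax, ∀ M ∈ I sv,
      ((SF.filter (fun q => keyM P₀ (nq q) = M)).card : ℝ) ≤ K₃ * (N₀ : ℝ) ^ δ * (A / sv + 6) := by
    intro sv hsv M hMI
    simp only [Finset.mem_filter, Finset.mem_Icc, I] at hMI hsv
    obtain ⟨⟨⟨hM1, hMN⟩, -⟩, hvM⟩ := hMI
    have hsvpos : (0 : ℝ) < sv := by exact_mod_cast hsv.1
    set m : ℝ := M * B / (R * sv) with hmdef
    have hmpos : 0 < m := by positivity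
    obtain ⟨hWfin, hWcard⟩ := perM_bound hmax hD hY0 hmpos (M := M) (by omega)
    have hsub : (↑(SF.filter (fun q => keyM P₀ (nq q) = M)) : Set (ℤ × ℤ)) ⊆
        {q : ℤ × ℤ | Int.gcd q.1 q.2 = 1 ∧ (M : ℤ) ∣ F.eval q.1 q.2 ∧ Y ≤ (Mplus F q : ℝ) ∧
          (Mplus F q : ℝ) < 2 * Y ∧ |(F.eval q.1 q.2 : ℝ)| ≤ m} := by
      intro q hq
      rw [Finset.mem_coe, Finset.mem_filter, hmemSF] at hq
      obtain ⟨hqS, hqM⟩ := hq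
      obtain ⟨-, -, -, -, hnle⟩ := hkey q hqS
      rw [hqM, hvM] at hnle
      refine ⟨hqS.1, ?_, hqS.2.1, hqS.2.2.1, ?_⟩
      · have : M ∣ nq q := hqM ▸ ⟨_, (keyM_mul_uPart P₀ (hnq0 q hqS)).symm⟩
        exact Int.natCast_dvd.mpr this
      · rw [← hnq_cast]; exact hnle
    have hms : 12288 * m * Y ^ (-(1 / 6 : ℝ)) / M = A / sv := by
      rw [hmdef, hAdef]; field_simp
    calc ((SF.filter (fun q => keyM P₀ (nq q) = M)).card : ℝ)
        = ((↑(SF.filter (fun q => keyM P₀ (nq q) = M)) : Set (ℤ × ℤ)).ncard : ℕ) := by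
          rw [Set.ncard_coe_finset]
      _ ≤ 3 ^ M.primeFactors.card * (12288 * m * Y ^ (-(1 / 6 : ℝ)) / M + 6) :=
          le_trans (by exact_mod_cast Set.ncard_le_ncard hsub hWfin) hWcard
      _ ≤ K₃ * (N₀ : ℝ) ^ δ * (A / sv + 6) := by
          rw [hms]; gcongr; exact hN₀pos hM1 hMN
  -- number of moduli per `sv` (Rankin)
  have hI : ∀ sv ∈ Finset.Icc 1 Smax, ((I sv).card : ℝ) ≤ (N₀ : ℝ) ^ δ * (K₁ * X ^ δ) := by
    intro sv hsv
    obtain ⟨hsv1, hsvS⟩ := Finset.mem_Icc.mp hsv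
    have hr1 : 1 ≤ Dn * t * sv := Nat.one_le_iff_ne_zero.mpr (by positivity)
    have hP : ∀ p ∈ (Dn * t * sv).primeFactors, 2 ≤ p := fun p hp =>
      (Nat.prime_of_mem_primeFactors hp).two_le
    calc ((I sv).card : ℝ) ≤ (((Finset.Icc 1 N₀).filter
          (fun M => M.primeFactors ⊆ (Dn * t * sv).primeFactors)).card : ℝ) := by
          exact_mod_cast Finset.card_le_card (Finset.filter_subset _ _)
      _ ≤ (N₀ : ℝ) ^ δ * ∏ p ∈ (Dn * t * sv).primeFactors, (1 - (p : ℝ) ^ (-δ))⁻¹ :=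
          Literature.NumberTheory.DiophantineGeometry.AbcHits.supportedCount_le_rankin hδ _ hP N₀
      _ ≤ (N₀ : ℝ) ^ δ * (K₁ * ((Dn * t * sv : ℕ) : ℝ) ^ δ) := by
          gcongr; exact hK₁b _ hr1
      _ ≤ (N₀ : ℝ) ^ δ * (K₁ * X ^ δ) := by
          gcongr
          have hsvB : (sv : ℝ) ≤ B := le_trans (by exact_mod_cast hsvS)
            ((Nat.floor_le (by positivity)).trans (min_le_right _ _))
          push_cast; rw [hXdef]
          have : (Dn : ℝ) * t * sv ≤ Dn * t * B := by gcongr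
          nlinarith [this, show (0:ℝ) ≤ (Dn : ℝ) * t * B from by positivity,
            show (Dn : ℝ) * t * B * 1 ≤ Dn * t * B * Y from by gcongr]
  -- summation
  have hsum : (SF.card : ℝ) ≤ (N₀ : ℝ) ^ δ * (K₁ * X ^ δ) * (K₃ * (N₀ : ℝ) ^ δ) *
      (A * (1 + Real.log Smax) + 6 * Smax) := by
    calc (SF.card : ℝ) ≤ ∑ sv ∈ Finset.Icc 1 Smax, ∑ M ∈ I sv,
          ((SF.filter (fun q => keyM P₀ (nq q) = M)).card : ℝ) := by
          have h1 : SF.card ≤ ∑ sv ∈ Finset.Icc 1 Smax, ∑ M ∈ I sv,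
              (SF.filter (fun q => keyM P₀ (nq q) = M)).card :=
            (Finset.card_le_card hcover).trans (Finset.card_biUnion_le.trans
              (Finset.sum_le_sum fun sv _ => Finset.card_biUnion_le))
          exact_mod_cast h1
      _ ≤ ∑ sv ∈ Finset.Icc 1 Smax, ∑ _M ∈ I sv, K₃ * (N₀ : ℝ) ^ δ * (A / sv + 6) :=
          Finset.sum_le_sum fun sv hsv => Finset.sum_le_sum fun M hM => hpiece sv hsv M hM
      _ = ∑ sv ∈ Finset.Icc 1 Smax, (I sv).card * (K₃ * (N₀ : ℝ) ^ δ * (A / sv + 6)) := by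
          simp [Finset.sum_const, nsmul_eq_mul]
      _ ≤ ∑ sv ∈ Finset.Icc 1 Smax, (N₀ : ℝ) ^ δ * (K₁ * X ^ δ) * (K₃ * (N₀ : ℝ) ^ δ * (A / sv + 6)) := by
          refine Finset.sum_le_sum fun sv hsv => ?_
          have : (0 : ℝ) ≤ A / sv + 6 := by
            have : (0:ℝ) < sv := by exact_mod_cast (Finset.mem_Icc.mp hsv).1
            positivity
          gcongr
          exact hI sv hsv
      _ = (N₀ : ℝ) ^ δ * (K₁ * X ^ δ) * (K₃ * (N₀ : ℝ) ^ δ) *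
          ∑ sv ∈ Finset.Icc 1 Smax, (A / sv + 6) := by
          rw [Finset.mul_sum]
          exact Finset.sum_congr rfl fun sv _ => by ring
      _ = (N₀ : ℝ) ^ δ * (K₁ * X ^ δ) * (K₃ * (N₀ : ℝ) ^ δ) *
          (A * ∑ sv ∈ Finset.Icc 1 Smax, (sv : ℝ)⁻¹ + 6 * Smax) := by
          congr 1
          rw [Finset.sum_add_distrib, Finset.sum_const, Nat.card_Icc, nsmul_eq_mul, Finset.mul_sum]
          simp only [div_eq_mul_inv, add_tsub_cancel_right]
          ring
      _ ≤ _ := by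
          gcongr
          exact sum_inv_Icc_le Smax
  -- the elementary bounds on the factors
  have hX1 : 1 ≤ X := by
    rw [hXdef]
    have : (1 : ℝ) ≤ Dn := by exact_mod_cast hDn
    have : (1 : ℝ) ≤ t := by exact_mod_cast ht0
    calc (1 : ℝ) = 1 * 1 * 1 * 1 := by ring
      _ ≤ Dn * Y * B * t := by gcongr
  have hXδ1 : 1 ≤ X ^ δ := Real.one_le_rpow hX1 hδ.le
  have hN₀ : (N₀ : ℝ) ^ δ ≤ 2 * X ^ δ := by
    have h1 : (N₀ : ℝ) ≤ 2 * X := by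
      calc (N₀ : ℝ) ≤ Real.sqrt (2 * Y) := Nat.floor_le (Real.sqrt_nonneg _)
        _ ≤ 2 * Y := by
          rw [Real.sqrt_le_left (by positivity)]; nlinarith
        _ ≤ 2 * X := by
          rw [hXdef]
          have : (1 : ℝ) ≤ Dn := by exact_mod_cast hDn
          have : (1 : ℝ) ≤ t := by exact_mod_cast ht0
          calc 2 * Y = 2 * (1 * Y * 1 * 1) := by ring
            _ ≤ 2 * (Dn * Y * B * t) := by gcongr
    calc (N₀ : ℝ) ^ δ ≤ (2 * X) ^ δ := Real.rpow_le_rpow (by positivity) h1 hδ.le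
      _ = 2 ^ δ * X ^ δ := Real.mul_rpow (by norm_num) (by positivity)
      _ ≤ 2 ^ (1 : ℝ) * X ^ δ := by
          apply mul_le_mul_of_nonneg_right _ (by positivity)
          exact Real.rpow_le_rpow_of_exponent_le (by norm_num) hδ1
      _ = 2 * X ^ δ := by rw [Real.rpow_one]
  have hSw : (Smax : ℝ) ≤ w := (Nat.floor_le (by positivity)).trans (min_le_left _ _)
  have hlog : 1 + Real.log Smax ≤ (1 + 1 / δ) * X ^ δ := by
    have hSB : (Smax : ℝ) ≤ B := (Nat.floor_le (by positivity)).trans (min_le_right _ _)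
    have hBX : B ≤ X := by
      rw [hXdef]
      have : (1 : ℝ) ≤ Dn := by exact_mod_cast hDn
      have : (1 : ℝ) ≤ t := by exact_mod_cast ht0
      calc B = 1 * 1 * B * 1 := by ring
        _ ≤ Dn * Y * B * t := by gcongr
    have hlogS : Real.log Smax ≤ Real.log X := by
      rcases Nat.eq_zero_or_pos Smax with h | h
      · rw [h, Nat.cast_zero, Real.log_zero]; exact Real.log_nonneg hX1
      · exact Real.log_le_log (by exact_mod_cast h) (hSB.trans hBX)
    have hlogX : Real.log X ≤ X ^ δ / δ := Real.log_le_rpow_div (by positivity) hδ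
    calc 1 + Real.log Smax ≤ X ^ δ + X ^ δ / δ := by linarith
      _ = (1 + 1 / δ) * X ^ δ := by ring
  have hX4 : X ^ δ * X ^ δ * X ^ δ * X ^ δ = X ^ (4 * δ) := by
    have hX0 : 0 < X := by linarith
    rw [show 4 * δ = δ + δ + δ + δ by ring, Real.rpow_add hX0, Real.rpow_add hX0, Real.rpow_add hX0]
  have hX4ε : X ^ (4 * δ) ≤ X ^ ε := Real.rpow_le_rpow_of_exponent_le hX1 hδε
  -- conclusion
  have hw0 : 0 ≤ w := by linarith
  have hAw : A + 6 * w ≤ 12288 * (B * Y ^ (-(1 / 6 : ℝ)) / R + w) := by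
    have : A = 12288 * (B * Y ^ (-(1 / 6 : ℝ)) / R) := by rw [hAdef]; ring
    rw [this, mul_add]; linarith
  have hncard : (S.ncard : ℝ) = SF.card := by rw [Set.ncard_eq_toFinset_card S hSfin]
  rw [hncard]
  set T1 : ℝ := (N₀ : ℝ) ^ δ with hT1
  set XD : ℝ := X ^ δ with hXD
  set L : ℝ := 1 + Real.log Smax with hL
  set cδ : ℝ := 1 + 1 / δ with hcδ
  have hL0 : 0 ≤ L := by have := Real.log_natCast_nonneg Smax; rw [hL]; linarith
  have hcδ1 : 1 ≤ cδ := by have : 0 < 1 / δ := (by positivity); linarith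
  have hQ : A * L + 6 * Smax ≤ cδ * XD * (A + 6 * w) := by
    have h1 : A * L ≤ A * (cδ * XD) := mul_le_mul_of_nonneg_left hlog hApos
    have h2 : 6 * (Smax : ℝ) ≤ 6 * w := by linarith
    have h3 : 6 * w ≤ cδ * XD * (6 * w) :=
      le_mul_of_one_le_left (by positivity) (one_le_mul_of_one_le_of_one_le hcδ1 hXδ1)
    calc A * L + 6 * Smax ≤ A * (cδ * XD) + 6 * w := add_le_add h1 h2
      _ ≤ A * (cδ * XD) + cδ * XD * (6 * w) := by linarith
      _ = cδ * XD * (A + 6 * w) := by ring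
  have hP : T1 * (K₁ * XD) * (K₃ * T1) ≤ (2 * XD) * (K₁ * XD) * (K₃ * (2 * XD)) := by
    gcongr
  have hQ0 : 0 ≤ A * L + 6 * Smax := by positivity
  calc (SF.card : ℝ) ≤ T1 * (K₁ * XD) * (K₃ * T1) * (A * L + 6 * Smax) := hsum
    _ ≤ (2 * XD) * (K₁ * XD) * (K₃ * (2 * XD)) * (cδ * XD * (A + 6 * w)) :=
        mul_le_mul hP hQ hQ0 (by positivity)
    _ = 4 * K₁ * K₃ * cδ * (XD * XD * XD * XD) * (A + 6 * w) := by ring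
    _ ≤ 4 * K₁ * K₃ * cδ * X ^ ε * (12288 * (B * Y ^ (-(1 / 6 : ℝ)) / R + w)) := by
        rw [hXD, hX4]
        gcongr
    _ = 4 * 12288 * K₁ * K₃ * (1 + 1 / δ) * ((Dn : ℝ) * Y * B * t) ^ ε *
        (B * Y ^ (-(1 / 6 : ℝ)) / R + w) := by rw [hcδ, hXdef]; ring

end Summit.ABC.ABC.Theorems.SharpModerateLaw

end
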